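import Summits.ResolutionOfSingularities.KangarooAtlas.MizutaniInvFormsLevel
import Summits.ResolutionOfSingularities.KangarooAtlas.MizutaniSupportReduction
import Summits.ResolutionOfSingularities.KangarooAtlas.MizutaniPTowerFin
import Summits.ResolutionOfSingularities.KangarooAtlas.MizutaniConjecture
import HarnessLib

/-!
# Mizutani's conjecture `m(e) = 2p^e − 1` — THE LOWER BOUND `m(e) ≥ 2p^e − 1`, unconditionally

Cell topic `Summits/ResolutionOfSingularities/KangarooAtlas` (pub-rosobs); namespace
`Summit.ResolutionOfSingularities.KangarooAtlas.Mizutani`.  Part of the Lean transcription of the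
in-house note MIZUTANI-PROOF-g59 (AI-written, AI-audited; *AI review is weaker than expert review*; NOT a
resolution theorem, NOT summit progress).  This file ASSEMBLES the chain:

**`mizutaniLowerBound : MizutaniLowerBound p e`** for every prime `p` and every `e` — the obligation of
`MizutaniConjecture.lean` (Mizutani 1973, Remark 2.10: "it is quite likely that `m(e) = 2p^e − 1`"; the lower
bound half), i.e. for every field `k` of characteristic `p`, every point `𝔭` of `ℙ^n_k` whose Hironaka scheme
(in Oda's description `invForms`/`ExponentLE`/`hsDimAt`, `Literature/…/HironakaGroupScheme.lean`) has exponent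
`≥ e`, `dim B(𝔭) ≥ 2p^e − 1`.  No hypothesis is left: encloser-1's THEOREM F (`theoremF_rootTower`, the note's
§§4–9) is fed by the §3 DICTIONARY of this seat (`MizutaniDiffPairing` … `MizutaniPTowerFin`): exact exponent ⇒ a
form `a ∈ (L_B)_{e*}` with a GENUINE tensor `Σ_i a_i ⊗ c_{ij}` (duality + the split lemma), support reduction to
`≤ dim B(𝔭) + 1` nonzero coordinates, finite witnesses and a finite `p`-independent envelope `k^{p^{e*}}(b)`,
THEOREM F there: `2p^{e*} ≤ rank ≤ dim B(𝔭) + 1`.  This discharges the hypothesis `hOda` of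
`MizutaniLowerBoundOfOda.lean`; with Mizutani's attainment (`MizutaniAttained`, cited) it gives
`MizutaniConjecture p e` (`mizutaniConjecture_of_attained`).

References: [Mizutani1973HironakaGroupSchemes] Remark 2.10, Thm. 2.8; [Oda1983HironakaGroupSchemeII] §2 (p. 1168),
Cor. 2.3, Thm. 3.1; in-house note MIZUTANI-PROOF-g59 §3, Cor. 3.2, Cor. 10.1.
-/

open MvPolynomial TensorProduct Literature.AlgebraicGeometry.Resolution.HironakaScheme

namespace Summit.ResolutionOfSingularities.KangarooAtlas.Mizutani

universe u

section Core

variable (k : Type u) [Field k] (p : ℕ) [hp : Fact p.Prime] [CharP k p] {n : ℕ}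
  (𝔭 : Ideal (MvPolynomial (Fin (n + 1)) k))

/-- **The core estimate at the exact exponent** (MIZUTANI-PROOF-g59 Prop. 3.1 + (e) + THEOREM F): if
`exponent(B(𝔭)) ≤ e' + 1` but `¬ exponent(B(𝔭)) ≤ e'`, then `2p^{e'+1} ≤ dim B(𝔭) + 1` (dimension read at
level `e' + 1`). [cite: Mizutani1973HironakaGroupSchemes, Remark 2.10 (in-house proof §3 Prop. 3.1 (e), Cor. 3.2)] -/
theorem two_mul_pow_le_hsDimAt_succ (hP : IsPoint k 𝔭) (e' : ℕ) (hE : ExponentLE k p 𝔭 (e' + 1))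
    (hne : ¬ ExponentLE k p 𝔭 e') : 2 * p ^ (e' + 1) ≤ hsDimAt k p 𝔭 (e' + 1) + 1 := by
  classical
  -- (1) a new form at the exact exponent, with a genuine tensor
  have h𝔭top : 𝔭 ≠ ⊤ := fun h => hP.2.2 (h ▸ le_top)
  obtain ⟨a, ha, hnot⟩ := exists_mem_invForms_not_mem_span k p 𝔭 h𝔭top hE hne
  obtain ⟨j₀, -, hI₀⟩ := exists_rho_not_mem_split k p 𝔭 hP.1 e' ha hnot
  -- (2) the subspaces `P ⊇ (L_B)_{e'+1}` ("all tensors in J^q") and `P'` ("all tensors split")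
  let Z : (Fin (n + 1) → k) →ₗ[k] (Fin (cdim k p 𝔭 (e' + 1)) → k ⊗[(frobPow k p (e' + 1))] k) :=
    LinearMap.pi fun j => rho k p 𝔭 (e' + 1) j
  let T : Submodule k (Fin (cdim k p 𝔭 (e' + 1)) → k ⊗[(frobPow k p (e' + 1))] k) :=
    Submodule.pi Set.univ fun _ => (KaehlerDifferential.ideal (frobPow k p (e' + 1)) k ^ p ^ (e' + 1)).restrictScalars k
  let T' : Submodule k (Fin (cdim k p 𝔭 (e' + 1)) → k ⊗[(frobPow k p (e' + 1))] k) :=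
    Submodule.pi Set.univ fun _ => (frobIdeal k p (frobPow k p (e' + 1)) ^ p ^ e').restrictScalars k
  let P : Submodule k (Fin (n + 1) → k) := T.comap Z
  let P' : Submodule k (Fin (n + 1) → k) := T'.comap Z
  have hmemP : ∀ x : Fin (n + 1) → k, x ∈ P ↔ ∀ j, rho k p 𝔭 (e' + 1) j x ∈
      KaehlerDifferential.ideal (frobPow k p (e' + 1)) k ^ p ^ (e' + 1) := by
    intro x
    simp only [P, T, Z, Submodule.mem_comap, Submodule.mem_pi, Set.mem_univ, true_implies,
      Submodule.restrictScalars_mem, LinearMap.pi_apply]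
  have hmemP' : ∀ x : Fin (n + 1) → k, x ∈ P' ↔ ∀ j, rho k p 𝔭 (e' + 1) j x ∈ frobIdeal k p (frobPow k p (e' + 1)) ^ p ^ e' := by
    intro x
    simp only [P', T', Z, Submodule.mem_comap, Submodule.mem_pi, Set.mem_univ, true_implies,
      Submodule.restrictScalars_mem, LinearMap.pi_apply]
  have hNP : invForms k p 𝔭 (e' + 1) ≤ P := fun x hx => (hmemP x).mpr ((mem_invForms_iff_rho k p 𝔭 _ x).mp hx)
  have haP : a ∈ P := hNP ha
  have haP' : a ∉ P' := fun h => hI₀ ((hmemP' a).mp h j₀)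
  -- (3) support reduction
  obtain ⟨v, hvP, hvP', hcard⟩ := exists_small_support' P P' haP haP'
  rw [Fintype.card_fin] at hcard
  have hvJ := (hmemP v).mp hvP
  obtain ⟨j, hjI⟩ : ∃ j, rho k p 𝔭 (e' + 1) j v ∉ frobIdeal k p (frobPow k p (e' + 1)) ^ p ^ e' := by
    by_contra h
    push Not at h
    exact hvP' ((hmemP' v).mpr h)
  set ω := rho k p 𝔭 (e' + 1) j v with hω
  have hωsum : ω = ∑ i ∈ fsupp v, v i ⊗ₜ[(frobPow k p (e' + 1))] coord k p 𝔭 (e' + 1) i j := by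
    rw [hω, rho_apply]
    symm
    refine Finset.sum_subset (Finset.subset_univ _) fun i _ hi => ?_
    rw [mem_fsupp, not_not] at hi
    rw [hi, TensorProduct.zero_tmul]
  -- (4) `k` is infinite; finite witnesses; a finite `p`-independent envelope
  haveI : Infinite k := infinite_of_mem_pow_not_mem (m := p ^ (e' + 1) - 1)
    (by rw [← pow_eq_sub_one_add_one p (e' + 1)]; exact hvJ j) hjI
  obtain ⟨Y, hY⟩ := exists_finset_realised_pow (K := frobPow k p (e' + 1)) (p ^ (e' + 1)) (hvJ j)
  set Y' : Finset k := Y ∪ Finset.univ.image v ∪ Finset.univ.image (fun i => coord k p 𝔭 (e' + 1) i j) with hY'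
  obtain ⟨s, b, hb1, hY'F⟩ := exists_pIndep_adjoin (p := p) (e' + 1) Y'
  have hbe : PIndep p (e' + 1) b := hb1.of_one _ (Nat.le_add_left 1 e')
  set F := towerField (e' + 1) b with hF
  have hYF : (↑Y : Set k) ⊆ (F : Set k) :=
    Set.Subset.trans (Finset.coe_subset.mpr
      ((Finset.subset_union_left).trans (Finset.subset_union_left))) hY'F
  have hvF : ∀ i, v i ∈ F := fun i => hY'F (by
    rw [hY', Finset.coe_union, Finset.coe_union]
    exact Or.inl (Or.inr (by simp)))
  have hcF : ∀ i, coord k p 𝔭 (e' + 1) i j ∈ F := fun i => hY'F (by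
    rw [hY', Finset.coe_union]
    exact Or.inr (by simp))
  obtain ⟨ω₂, hω₂J, hω₂eq⟩ := ((realised_iff (frobPow k p (e' + 1))).mp hY) F hYF
  -- the explicit short preimage of `ω`
  set ω₂' : F ⊗[(frobPow k p (e' + 1))] F := ∑ i ∈ fsupp v, (⟨v i, hvF i⟩ : F) ⊗ₜ[(frobPow k p (e' + 1))] (⟨coord k p 𝔭 (e' + 1) i j, hcF i⟩ : F)
    with hω₂'
  have hmap : tensorIncl (frobPow k p (e' + 1)) F ω₂' = ω := by
    rw [hωsum, hω₂', map_sum]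
    refine Finset.sum_congr rfl fun i _ => ?_
    rw [Algebra.TensorProduct.map_tmul]
    rfl
  have hω₂eq' : ω₂ = ω₂' := tensorIncl_injective (frobPow k p (e' + 1)) F (hω₂eq.trans hmap.symm)
  -- (5) THEOREM F in the finite tower
  haveI : Infinite (frobPow k p (e' + 1)) := infinite_frobPow (k := k) (p := p) (e := e' + 1)
  have hJ' : ω₂' ∈ KaehlerDifferential.ideal (frobPow k p (e' + 1)) F ^ p ^ (e' + 1) := hω₂eq' ▸ hω₂J
  have hI' : ω₂' ∉ frobPowerIdeal (frobPow k p (e' + 1)) p ^ p ^ (e' + 1 - 1) := by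
    rw [Nat.add_sub_cancel]
    refine not_mem_of_map_not_mem (map_frobPowerIdeal_pow_le (frobPow k p (e' + 1)) F (p ^ e')) ?_
    rw [hmap]
    exact hjI
  have hF := theoremF_of_mem_pow (isRootTower_adjoin hbe) (finrank_adjoin_eq hbe) ω₂' hJ' hI'
  -- (6) the rank is at most the number of nonzero coordinates; dimension bookkeeping
  have hrank : tensorRank (frobPow k p (e' + 1)) ω₂' ≤ (fsupp v).card := tensorRank_sum_tmul_le_card (frobPow k p (e' + 1)) _ _ _
  haveI : FiniteDimensional k P := FiniteDimensional.finiteDimensional_submodule P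
  have hfin : Module.finrank k (invForms k p 𝔭 (e' + 1)) ≤ Module.finrank k P := Submodule.finrank_mono hNP
  unfold hsDimAt
  omega

end Core

/-! ## The lower bound and the conjecture -/

/-- **`m(e) ≥ 2p^e − 1` (Mizutani 1973, Remark 2.10; lower bound), for ALL `p`, `e`**: every Hironaka additive
group scheme of exponent `≥ e` over any field of characteristic `p` has dimension `≥ 2p^e − 1` — in Oda's
description of the invariant additive forms (`MizutaniLowerBound p e`, `MizutaniConjecture.lean`).  Unconditional:
THEOREM F (encloser-1, `theoremF_rootTower`) + this seat's dictionary; the hypothesis `hOda` of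
`MizutaniLowerBoundOfOda.lean` is discharged.  AI-written and AI-reviewed only (*AI review is weaker than expert
review*); not a resolution theorem. [cite: Mizutani1973HironakaGroupSchemes, Remark 2.10 ("It is quite likely that m(e) = 2p^e − 1"); Oda1983HironakaGroupSchemeII, §2 (p. 1168)] -/
theorem mizutaniLowerBound (p : ℕ) [hp : Fact p.Prime] (e : ℕ) : MizutaniLowerBound.{u} p e := by
  intro k _ _ n 𝔭 e₀ hP hE₀ hlt
  rcases Nat.eq_zero_or_pos e with rfl | he
  · have := one_le_hsDimAt k p 𝔭 hP e₀
    rw [pow_zero]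
    omega
  obtain ⟨eS, hES, hmin, hle₀⟩ := exists_exact_exponent k p 𝔭 hE₀
  have heS : e ≤ eS := by
    by_contra h
    exact hlt eS (by omega) hES
  obtain ⟨e', rfl⟩ : ∃ e', eS = e' + 1 := ⟨eS - 1, by omega⟩
  rw [hsDimAt_eq_of_exponentLE k p 𝔭 hES hle₀]
  have hmono : 2 * p ^ e ≤ 2 * p ^ (e' + 1) := Nat.mul_le_mul_left 2 (Nat.pow_le_pow_right hp.out.pos heS)
  exact le_trans hmono (two_mul_pow_le_hsDimAt_succ k p 𝔭 hP e' hES (hmin e' (Nat.lt_succ_self e')))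

/-- **Mizutani's conjecture `m(e) = 2p^e − 1` relative to his attainment**: the lower bound above together with
the cited named fact `MizutaniAttained p e` (Mizutani's schemes `H_e`, Remark 2.10) gives `MizutaniConjecture p e`.
[cite: Mizutani1973HironakaGroupSchemes, Remark 2.10] -/
theorem mizutaniConjecture_of_attained (p : ℕ) [Fact p.Prime] (e : ℕ) (hAtt : MizutaniAttained.{u} p e) :
    MizutaniConjecture.{u} p e :=
  ⟨mizutaniLowerBound p e, hAtt⟩

end Summit.ResolutionOfSingularities.KangarooAtlas.Mizutani
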